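import Mathlib

/-!
# Core transfer for `RamseyUncertifiable.ResolutionUncertainty`

Crux `stmt-PneNP-9816` (`Summit.PneNP.PneNP.Theses.RamseyUncertifiable.ResolutionUncertainty`),
line `box-dag-self-gadget-lifting`, stub `stub_coreTransfer`.

Pure glue.  The Prömel–Rödl core of a 2-Ramsey graph `G` on `Fin n` is handed over as a finset
`S ⊆ Fin n` with `n ^ (3/4) ≤ |S|`, inside which both `G` and `Gᶜ` have edge density `≥ δ` between
any two disjoint subsets of size `≥ |S| ^ (1 - β)`.  The rest of the line wants this core as a graph
on `Fin m`: we put `m := |S|`, pull `G` back along the increasing enumeration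
`e : Fin m ↪ Fin n` of `S` (`Finset.orderEmbOfFin`), check `n ^ 3 ≤ m ^ 4` in `ℕ`, and transfer
the density property to `G.comap e` and `(G.comap e)ᶜ` through `Finset.map e`.
-/

-- the mandated namespace `Summit.PneNP.PneNP.…` (summit = problem = `PneNP`) repeats `PneNP` by design
set_option linter.dupNamespace false

namespace Summit.PneNP.PneNP.Theorems.RamseyUncertifiableResolutionUncertainty

/-- The edges of the pulled-back graph `G.comap e` between `A` and `B` are carried by `e × e`
exactly onto the edges of `G` between `A.map e` and `B.map e`. -/
theorem map_interedges_comap {V W : Type*} (G : SimpleGraph W) [DecidableRel G.Adj] (e : V ↪ W)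
    (A B : Finset V) :
    ((G.comap e).interedges A B).map (e.prodMap e) = G.interedges (A.map e) (B.map e) := by
  ext ⟨x, y⟩
  simp only [Finset.mem_map, SimpleGraph.mk_mem_interedges_iff, Function.Embedding.coe_prodMap,
    Prod.exists, Prod.map_apply, Prod.mk.injEq, SimpleGraph.comap_adj]
  constructor
  · rintro ⟨a, b, ⟨ha, hb, h⟩, rfl, rfl⟩
    exact ⟨⟨a, ha, rfl⟩, ⟨b, hb, rfl⟩, h⟩
  · rintro ⟨⟨a, ha, rfl⟩, ⟨b, hb, rfl⟩, h⟩
    exact ⟨a, b, ⟨ha, hb, h⟩, rfl, rfl⟩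

/-- Same as `map_interedges_comap` for the complements: since `e` is injective,
`(G.comap e)ᶜ`-edges between `A` and `B` are carried by `e × e` exactly onto the `Gᶜ`-edges between
`A.map e` and `B.map e`. -/
theorem map_interedges_comap_compl {V W : Type*} [DecidableEq V] [DecidableEq W]
    (G : SimpleGraph W) [DecidableRel G.Adj] (e : V ↪ W) (A B : Finset V) :
    ((G.comap e)ᶜ.interedges A B).map (e.prodMap e) = Gᶜ.interedges (A.map e) (B.map e) := by
  ext ⟨x, y⟩
  simp only [Finset.mem_map, SimpleGraph.mk_mem_interedges_iff, Function.Embedding.coe_prodMap,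
    Prod.exists, Prod.map_apply, Prod.mk.injEq, SimpleGraph.compl_adj, SimpleGraph.comap_adj]
  constructor
  · rintro ⟨a, b, ⟨ha, hb, hne, h⟩, rfl, rfl⟩
    exact ⟨⟨a, ha, rfl⟩, ⟨b, hb, rfl⟩, e.injective.ne hne, h⟩
  · rintro ⟨⟨a, ha, rfl⟩, ⟨b, hb, rfl⟩, hne, h⟩
    exact ⟨a, b, ⟨ha, hb, fun hab => hne (congrArg e hab), h⟩, rfl, rfl⟩

/-- Edge density is invariant under pulling back along an embedding:
`d_{G.comap e}(A, B) = d_G(e A, e B)`. -/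
theorem edgeDensity_comap {V W : Type*} (G : SimpleGraph W) [DecidableRel G.Adj] (e : V ↪ W)
    (A B : Finset V) :
    (G.comap e).edgeDensity A B = G.edgeDensity (A.map e) (B.map e) := by
  rw [SimpleGraph.edgeDensity_def, SimpleGraph.edgeDensity_def, ← map_interedges_comap G e A B,
    Finset.card_map, Finset.card_map, Finset.card_map]

/-- Edge density of the complement is invariant under pulling back along an embedding:
`d_{(G.comap e)ᶜ}(A, B) = d_{Gᶜ}(e A, e B)`. -/
theorem edgeDensity_comap_compl {V W : Type*} [DecidableEq V] [DecidableEq W]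
    (G : SimpleGraph W) [DecidableRel G.Adj] (e : V ↪ W) (A B : Finset V) :
    (G.comap e)ᶜ.edgeDensity A B = Gᶜ.edgeDensity (A.map e) (B.map e) := by
  rw [SimpleGraph.edgeDensity_def, SimpleGraph.edgeDensity_def,
    ← map_interedges_comap_compl G e A B, Finset.card_map, Finset.card_map, Finset.card_map]

/-- From the real bound `n ^ (3/4) ≤ m` to the natural-number bound `n ^ 3 ≤ m ^ 4`. -/
theorem pow_three_le_pow_four_of_rpow_le {n m : ℕ} (h : (n : ℝ) ^ ((3 : ℝ) / 4) ≤ m) :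
    n ^ 3 ≤ m ^ 4 := by
  have h0 : (0 : ℝ) ≤ (n : ℝ) ^ ((3 : ℝ) / 4) := Real.rpow_nonneg (Nat.cast_nonneg n) _
  have h1 : ((n : ℝ) ^ ((3 : ℝ) / 4)) ^ 4 ≤ (m : ℝ) ^ 4 := pow_le_pow_left₀ h0 h 4
  have h2 : ((n : ℝ) ^ ((3 : ℝ) / 4)) ^ (4 : ℕ) = (n : ℝ) ^ (3 : ℕ) := by
    rw [← Real.rpow_mul_natCast (Nat.cast_nonneg n), ← Real.rpow_natCast]
    norm_num
  rw [h2] at h1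
  exact_mod_cast h1

/-- **Core transfer** (`PRCore → CoreComap`): the Prömel–Rödl core, given as a finset `S` of
`Fin n` with `n ^ (3/4) ≤ |S|` inside which `G` and `Gᶜ` are `δ`-dense between disjoint
`|S| ^ (1 - β)`-subsets, re-indexed as the graph `G.comap e` on `Fin m`, `m = |S|`, along the
increasing enumeration `e` of `S`; then `n ^ 3 ≤ m ^ 4` and the same two-sided density property holds
for `G.comap e` and `(G.comap e)ᶜ`. -/
theorem stub_coreTransfer :
    (∃ β δ : ℝ, 0 < β ∧ β < 1 ∧ 0 < δ ∧ ∃ n₀ : ℕ, ∀ n ≥ n₀, ∀ (G : SimpleGraph (Fin n)) [DecidableRel G.Adj],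
      G.CliqueFree (Nat.clog 2 (n ^ 2)) → Gᶜ.CliqueFree (Nat.clog 2 (n ^ 2)) →
      ∃ S : Finset (Fin n), (n : ℝ) ^ ((3 : ℝ) / 4) ≤ S.card ∧
        ∀ A ⊆ S, ∀ B ⊆ S, Disjoint A B →
          (S.card : ℝ) ^ (1 - β) ≤ A.card → (S.card : ℝ) ^ (1 - β) ≤ B.card →
          δ ≤ (G.edgeDensity A B : ℝ) ∧ δ ≤ (Gᶜ.edgeDensity A B : ℝ)) →
    ∃ β δ : ℝ, 0 < β ∧ β < 1 ∧ 0 < δ ∧ ∃ n₀ : ℕ, ∀ n : ℕ, n₀ ≤ n →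
      ∀ (G : SimpleGraph (Fin n)) [DecidableRel G.Adj],
        G.CliqueFree (Nat.clog 2 (n ^ 2)) → Gᶜ.CliqueFree (Nat.clog 2 (n ^ 2)) →
        ∃ (m : ℕ) (e : Fin m ↪ Fin n), n ^ 3 ≤ m ^ 4 ∧
          ∀ A B : Finset (Fin m), Disjoint A B → (m : ℝ) ^ (1 - β) ≤ A.card → (m : ℝ) ^ (1 - β) ≤ B.card →
            δ ≤ ((G.comap e).edgeDensity A B : ℝ) ∧ δ ≤ ((G.comap e)ᶜ.edgeDensity A B : ℝ) := by
  rintro ⟨β, δ, hβ0, hβ1, hδ, n₀, h⟩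
  refine ⟨β, δ, hβ0, hβ1, hδ, n₀, ?_⟩
  intro n hn G inst hG hGc
  obtain ⟨S, hS, hgood⟩ := h n hn G hG hGc
  refine ⟨S.card, (S.orderEmbOfFin rfl).toEmbedding, pow_three_le_pow_four_of_rpow_le hS, ?_⟩
  intro A B hAB hA hB
  have hsub : ∀ C : Finset (Fin S.card), C.map (S.orderEmbOfFin rfl).toEmbedding ⊆ S := by
    intro C x hx
    obtain ⟨a, -, rfl⟩ := Finset.mem_map.1 hx
    exact S.orderEmbOfFin_mem rfl a
  have hd : Disjoint (A.map (S.orderEmbOfFin rfl).toEmbedding)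
      (B.map (S.orderEmbOfFin rfl).toEmbedding) :=
    (Finset.disjoint_map _).2 hAB
  obtain ⟨h1, h2⟩ := hgood _ (hsub A) _ (hsub B) hd (by rw [Finset.card_map]; exact hA)
    (by rw [Finset.card_map]; exact hB)
  rw [edgeDensity_comap, edgeDensity_comap_compl]
  exact ⟨h1, h2⟩

end Summit.PneNP.PneNP.Theorems.RamseyUncertifiableResolutionUncertainty
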